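import Summits.ResolutionOfSingularities.ResolutionOfSingularities.Theorems.FrobeniusClosingPatchingRelPerfectDepthWeightTwoBPeel
import Summits.ResolutionOfSingularities.ResolutionOfSingularities.Theorems.FrobeniusClosingPatchingRelPerfectDepthWeightedSeqJBookkeeping
import Literature.AlgebraicGeometry.Resolution.BoundarySplitting
import HarnessLib

/-!
# Crux `PatchingRelPerfect` (stmt-ResolutionOfSingularities-16161), chain W5.2 — F7(α) = F5c, target `WeightTwoBoundaryJRnr₃`:
# PHASE-B^nr — the PEEL LOOP over the multiple host components and the `EndStateJR` at its end

[OURS · L1 W5.2 · rung tool] Replaces the role of NO printed item; NOT a statement of the manuscript under review; fact-free,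
format-free; AI-written (AI review is weaker than expert review).

THE LOOP (res-D-pv-052 AS stub-7's cut 11:38:11Z «stub-1 GO N7-loop»; MID := res-D-pv-055's `endPackage`).  At the END of the
non-reduced CJS transport the carried host is FACTORISED, `D' = monomialIdeal Pl`, over pairwise DISJOINT connected members of one
snc family `𝓔` (which also contains every boundary trace), none of them a boundary member, every exponent `≥ 1`, and no N-charged
member meets a component of exponent `≥ 2`.  Walking the list `Pl`: a component of exponent `1` is KEPT in the host (moved into
the prefix product `Kl.prod`), a component of exponent `e ≥ 2` is PEELED once at full multiplicity (`DepthSep.isWeightedSeqJR_peel`,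
p527073: `ν = μ = 2`, `m = e`, the identity of `E'`; it leaves the host and joins the boundary with host-exponent `e − 2 + w`,
N-exponent `w' + 0`).  At the end the host is `Kl.prod` — a product of pairwise disjoint exponent-one members of `𝓔` that are not
boundary members — so `Kl.prod :: boundaryOf ℬ''` is snc (`hasSNC_prod_cons`: merge disjoint members), `V(Kl.prod)` is regular, and
`𝔟'' = Kl.prod · monomialIdeal ℬ''` comes for free from the sequence (res-D-pv-021's `IsWeightedSeqJR.eq_host_mul_monomialIdeal`):
`EndStateJR`.

* §1 supports and stalks of list products; the boundary after a peel whose centre is not a boundary member;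
* §2 `hasSNC_prod_cons` — merging pairwise disjoint members of an snc family into their product;
* §3 **`exists_isWeightedSeqJR_prod_of_factorised`** — the loop (accumulator form, `E'` fixed);
* §4 **`exists_endStateJR_of_factorised`** — loop + END: from the factorised state to
  `∃ ρ'' 𝔟'' D'' ℬ'' 𝒟'', IsWeightedSeqJR 2 ρ'' 𝔟₀ 𝔟₀ [] [] 𝔟'' D'' ℬ'' 𝒟'' ∧ EndStateJR 𝔟'' D'' ℬ''` on the same `E'`.

## References
* J. Kollár, *Lectures on Resolution of Singularities* (2007), (3.111) Step 3. [Kollar2007]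
* E. Bierstone, D. Grigoriev, P. Milman, J. Włodarczyk, arXiv:1206.3090, §4 Step 2 (monomial part over the components). [BierstoneGrigorievMilmanWlodarczyk2011]
-/

-- `Summit.<Summit>.<Sub>.Theorems` with `Sub = Summit` (single-conjunct summit, D-0017)
set_option linter.dupNamespace false

noncomputable section

open CategoryTheory AlgebraicGeometry TopologicalSpace IsLocalRing
open Literature.AlgebraicGeometry.Resolution

namespace Summit.ResolutionOfSingularities.ResolutionOfSingularities.Theorems

universe u

namespace DepthSep

open DepthTargets

variable {E' E : Scheme.{u}}

/-! ## §1 Supports and stalks of products; the boundary after a peel -/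

/-- The support of a monomial ideal lies in the union of the supports of its sheaves. [folklore] -/
theorem support_monomialIdeal_subset (L : List (E'.IdealSheafData × ℕ)) :
    ((monomialIdeal L).support : Set E') ⊆ ⋃ p ∈ L, (p.1.support : Set E') := by
  induction L with
  | nil => simp [monomialIdeal_nil, Scheme.IdealSheafData.support_top]
  | cons p L ih =>
    intro x hx
    rw [monomialIdeal_cons, Scheme.IdealSheafData.support_mul] at hx
    change x ∈ ((p.1 ^ p.2).support : Set E') ∪ ((monomialIdeal L).support : Set E') at hx
    simp only [List.mem_cons, Set.iUnion_iUnion_eq_or_left, Set.mem_union]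
    rcases hx with hx | hx
    · left
      rcases Nat.eq_zero_or_pos p.2 with h0 | hpos
      · rw [h0, pow_zero, Scheme.IdealSheafData.one_eq_top, Scheme.IdealSheafData.support_top] at hx
        exact absurd hx id
      · rwa [Scheme.IdealSheafData.support_pow _ _ hpos.ne'] at hx
    · right; exact ih hx

/-- Off every member of a list, the stalk of the product is the unit ideal. [folklore] -/
theorem stalkIdeal_prod_eq_top_of_forall_not_mem (L : List E'.IdealSheafData) {x : E'}
    (h : ∀ K ∈ L, x ∉ K.support) : stalkIdeal L.prod x = ⊤ := by
  induction L with
  | nil => rw [List.prod_nil, Scheme.IdealSheafData.one_eq_top, stalkIdeal_top]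
  | cons K L ih =>
    rw [List.prod_cons, stalkIdeal_mul, stalkIdeal_eq_top_of_not_mem_support (h K List.mem_cons_self),
      ih fun K' hK' => h K' (List.mem_cons_of_mem _ hK'), Ideal.top_mul]

/-- At a point of exactly one member of a list with pairwise disjoint supports, the stalk of the product is that member's stalk.
[folklore] -/
theorem stalkIdeal_prod_eq_of_mem {L : List E'.IdealSheafData}
    (hdisj : L.Pairwise fun P Q => Disjoint (P.support : Set E') Q.support) {K : E'.IdealSheafData} (hK : K ∈ L) {x : E'}
    (hx : x ∈ K.support) : stalkIdeal L.prod x = stalkIdeal K x := by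
  induction L with
  | nil => exact absurd hK List.not_mem_nil
  | cons K₀ L ih =>
    rw [List.pairwise_cons] at hdisj
    rw [List.prod_cons, stalkIdeal_mul]
    rcases List.mem_cons.mp hK with rfl | hK'
    · rw [stalkIdeal_prod_eq_top_of_forall_not_mem L fun K' hK' hx' => Set.disjoint_left.mp (hdisj.1 K' hK') hx hx',
        Ideal.mul_top]
    · have hx0 : x ∉ K₀.support := fun hx0 => Set.disjoint_left.mp (hdisj.1 K hK') hx0 hx
      rw [stalkIdeal_eq_top_of_not_mem_support hx0, Ideal.top_mul, ih hdisj.2 hK']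

/-- The support of the product is the union of the supports (set form). [folklore] -/
theorem mem_support_prod_iff (L : List E'.IdealSheafData) (x : E') :
    x ∈ (L.prod.support : Set E') ↔ ∃ K ∈ L, x ∈ (K.support : Set E') := by
  rw [IdealSheafData.coe_support_prod]
  simp only [Set.mem_iUnion, exists_prop]

/-- **The boundary after a peel whose centre is NOT a boundary member**: its members are the old members and the centre (no
unit ideal is created). [folklore] -/
theorem mem_boundaryOf_peel_of_not_mem [IsLocallyNoetherian E'] {𝓔 : List E'.IdealSheafData} (h𝓔 : HasSNC 𝓔)
    {S : E'.IdealSheafData} (hS : S ∈ 𝓔) {ℬ : List (E'.IdealSheafData × ℕ)} (hℬ : ∀ B ∈ boundaryOf ℬ, B ∈ 𝓔)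
    (hSℬ : S ∉ boundaryOf ℬ) (a : ℕ) {D : E'.IdealSheafData}
    (hD : D ∈ boundaryOf (ℬ.map (fun p => (strictTransformIdeal (𝟙 E') S p.1, p.2)) ++ [(S.comap (𝟙 E'), a)])) :
    D ∈ boundaryOf ℬ ∨ D = S := by
  rw [boundaryOf, List.map_append, List.mem_append, List.map_map] at hD
  rcases hD with hD | hD
  · obtain ⟨p, hp, rfl⟩ := List.mem_map.mp hD
    have hp1 : p.1 ∈ boundaryOf ℬ := fst_mem_boundaryOf hp
    have hpS : p.1 ≠ S := fun h => hSℬ (h ▸ hp1)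
    left
    change strictTransformIdeal (𝟙 E') S p.1 ∈ boundaryOf ℬ
    rw [strictTransformIdeal_id_of_ne h𝓔 hS (hℬ p.1 hp1) hpS]
    exact hp1
  · right
    rw [List.map_singleton, List.mem_singleton] at hD
    rw [hD, Scheme.IdealSheafData.comap_id]

/-- Membership in the peeled exponent list: an entry is a transformed old entry (same sheaf, same exponent) or the new one.
[folklore] -/
theorem mem_peel_cases [IsLocallyNoetherian E'] {𝓔 : List E'.IdealSheafData} (h𝓔 : HasSNC 𝓔)
    {S : E'.IdealSheafData} (hS : S ∈ 𝓔) {𝒟 : List (E'.IdealSheafData × ℕ)} (h𝒟 : ∀ B ∈ boundaryOf 𝒟, B ∈ 𝓔)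
    (hS𝒟 : S ∉ boundaryOf 𝒟) (a : ℕ) {q : E'.IdealSheafData × ℕ}
    (hq : q ∈ 𝒟.map (fun p => (strictTransformIdeal (𝟙 E') S p.1, p.2)) ++ [(S.comap (𝟙 E'), a)]) :
    q ∈ 𝒟 ∨ q = (S, a) := by
  rcases List.mem_append.mp hq with hq | hq
  · obtain ⟨p, hp, rfl⟩ := List.mem_map.mp hq
    have hp1 : p.1 ∈ boundaryOf 𝒟 := fst_mem_boundaryOf hp
    have hpS : p.1 ≠ S := fun h => hS𝒟 (h ▸ hp1)
    left
    rw [strictTransformIdeal_id_of_ne h𝓔 hS (h𝒟 p.1 hp1) hpS]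
    exact hp
  · right
    rw [List.mem_singleton] at hq
    rw [hq, Scheme.IdealSheafData.comap_id]

/-! ## §2 Merging pairwise disjoint members of an snc family into their product -/

/-- **Merging disjoint members**: if `Kl` and `R` are drawn from one snc family, the members of `Kl` have pairwise disjoint supports
and none of them occurs in `R`, then `Kl.prod :: R` has simple normal crossings (at each point at most one factor of the product
passes, and the product has that factor's stalk there). [cite: BierstoneGrigorievMilmanWlodarczyk2011, Def. 3.1.1] -/
theorem hasSNC_prod_cons {𝓔 : List E'.IdealSheafData} (h𝓔 : HasSNC 𝓔) {Kl R : List E'.IdealSheafData}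
    (hKl : ∀ K ∈ Kl, K ∈ 𝓔) (hR : ∀ B ∈ R, B ∈ 𝓔) (hKlR : ∀ K ∈ Kl, K ∉ R)
    (hdisj : Kl.Pairwise fun P Q => Disjoint (P.support : Set E') Q.support) : HasSNC (Kl.prod :: R) := by
  classical
  intro x
  obtain ⟨hreg, u, hu, ⟨ι, hι, hιD⟩, hC⟩ := h𝓔 x
  refine ⟨hreg, u, hu, ?_, hC⟩
  by_cases hx : x ∈ (Kl.prod.support : Set E')
  · -- the unique factor through `x`
    obtain ⟨K, hK, hxK⟩ := (mem_support_prod_iff Kl x).mp hx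
    have hstalk : stalkIdeal Kl.prod x = stalkIdeal K x := stalkIdeal_prod_eq_of_mem hdisj hK hxK
    have hmemR : ∀ D : {D : E'.IdealSheafData // D ∈ Kl.prod :: R ∧ x ∈ D.support}, D.1 ≠ Kl.prod → D.1 ∈ R :=
      fun D hD => (List.mem_cons.mp D.2.1).resolve_left hD
    let ι' : {D : E'.IdealSheafData // D ∈ Kl.prod :: R ∧ x ∈ D.support} → Fin _ := fun D =>
      if hD : D.1 = Kl.prod then ι ⟨K, hKl K hK, hxK⟩ else ι ⟨D.1, hR _ (hmemR D hD), D.2.2⟩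
    refine ⟨ι', fun D₁ D₂ h12 => ?_, fun D => ?_⟩
    · by_cases h1 : D₁.1 = Kl.prod <;> by_cases h2 : D₂.1 = Kl.prod
      · exact Subtype.ext (h1.trans h2.symm)
      · exfalso
        simp only [ι', h1, h2, dif_pos, dif_neg, not_false_eq_true] at h12
        have h' : K = D₂.1 := congrArg Subtype.val (hι h12)
        exact hKlR K hK (h' ▸ hmemR D₂ h2)
      · exfalso
        simp only [ι', h1, h2, dif_pos, dif_neg, not_false_eq_true] at h12
        have h' : D₁.1 = K := congrArg Subtype.val (hι h12)
        exact hKlR K hK (h' ▸ hmemR D₁ h1)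
      · simp only [ι', h1, h2, dif_neg, not_false_eq_true] at h12
        have e := congrArg Subtype.val (hι h12)
        exact Subtype.ext e
    · by_cases hD : D.1 = Kl.prod
      · simp only [ι', hD, dif_pos]
        rw [hstalk]
        exact hιD ⟨K, hKl K hK, hxK⟩
      · simp only [ι', hD, dif_neg, not_false_eq_true]
        exact hιD ⟨D.1, hR _ (hmemR D hD), D.2.2⟩
  · -- the product does not pass through `x`
    have hmemR : ∀ D : {D : E'.IdealSheafData // D ∈ Kl.prod :: R ∧ x ∈ D.support}, D.1 ∈ R := fun D =>
      (List.mem_cons.mp D.2.1).resolve_left fun h => hx (h ▸ D.2.2)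
    refine ⟨fun D => ι ⟨D.1, hR _ (hmemR D), D.2.2⟩, fun D₁ D₂ h12 => ?_, fun D => hιD ⟨D.1, hR _ (hmemR D), D.2.2⟩⟩
    have e := congrArg Subtype.val (hι h12)
    exact Subtype.ext e

/-! ## §3 The peel loop -/

/-- Re-association of the host when an exponent-one component is kept: `K · (S¹ · Π) = (K ++ [S]).prod · Π`. [folklore] -/
theorem prod_mul_monomialIdeal_cons_one (Kl : List E'.IdealSheafData) (S : E'.IdealSheafData)
    (tail : List (E'.IdealSheafData × ℕ)) :
    Kl.prod * monomialIdeal ((S, 1) :: tail) = (Kl ++ [S]).prod * monomialIdeal tail := by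
  rw [monomialIdeal_cons, pow_one, ← mul_assoc, List.prod_append, List.prod_singleton]

/-- Re-association of the host when a multiple component is peeled: `K · (S^e · Π) = S^e · (K · Π)`. [folklore] -/
theorem prod_mul_monomialIdeal_cons (Kl : List E'.IdealSheafData) (S : E'.IdealSheafData) (e : ℕ)
    (tail : List (E'.IdealSheafData × ℕ)) :
    Kl.prod * monomialIdeal ((S, e) :: tail) = S ^ e * (Kl.prod * monomialIdeal tail) := by
  rw [monomialIdeal_cons, mul_left_comm]

/-- **THE PEEL LOOP (accumulator form, `E'` fixed).**  See the module docstring.  Hypotheses: an snc family `𝓔` on `E'`; the host of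
the current `IsWeightedSeqJR 2` state is `Kl.prod · monomialIdeal Pl` with `Kl` (kept exponent-one components) and the sheaves of `Pl`
members of `𝓔`, connected (`Pl`: irreducible supports), exponents `≥ 1`, the whole list `Kl ++ Pl.map fst` pairwise disjoint, none of
them boundary members; no N-charged member meets a `Pl`-component of exponent `≥ 2`.  Output: a longer sequence whose host is a
product `Kl''.prod` of pairwise disjoint members of `𝓔` that are not boundary members, the boundary still drawn from `𝓔`.
[cite: Kollar2007, (3.111) Step 3] -/
theorem exists_isWeightedSeqJR_prod_of_factorised [IsLocallyNoetherian E] [IsLocallyNoetherian E']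
    {𝓔 : List E'.IdealSheafData} (h𝓔 : HasSNC 𝓔) {𝔟₀ : E.IdealSheafData} :
    ∀ (Pl : List (E'.IdealSheafData × ℕ)) (Kl : List E'.IdealSheafData),
      (∀ p ∈ Pl, p.1 ∈ 𝓔) → (∀ K ∈ Kl, K ∈ 𝓔) → (∀ p ∈ Pl, 1 ≤ p.2) →
      (∀ p ∈ Pl, IsIrreducible (p.1.support : Set E')) →
      (Kl ++ Pl.map Prod.fst).Pairwise (fun P Q => Disjoint (P.support : Set E') Q.support) →
      ∀ {ρ : E' ⟶ E} {𝔟' : E'.IdealSheafData} {ℬ' 𝒟' : List (E'.IdealSheafData × ℕ)},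
        (∀ B ∈ boundaryOf ℬ', B ∈ 𝓔) → (∀ p ∈ Pl, p.1 ∉ boundaryOf ℬ') → (∀ K ∈ Kl, K ∉ boundaryOf ℬ') →
        (∀ q ∈ 𝒟', 0 < q.2 → ∀ p ∈ Pl, 2 ≤ p.2 → Disjoint (q.1.support : Set E') p.1.support) →
        IsWeightedSeqJR 2 ρ 𝔟₀ 𝔟₀ [] [] 𝔟' (Kl.prod * monomialIdeal Pl) ℬ' 𝒟' →
        ∃ (ρ'' : E' ⟶ E) (𝔟'' : E'.IdealSheafData) (ℬ'' 𝒟'' : List (E'.IdealSheafData × ℕ)) (Kl'' : List E'.IdealSheafData),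
          (∀ K ∈ Kl'', K ∈ 𝓔) ∧ (∀ B ∈ boundaryOf ℬ'', B ∈ 𝓔) ∧ (∀ K ∈ Kl'', K ∉ boundaryOf ℬ'') ∧
          Kl''.Pairwise (fun P Q => Disjoint (P.support : Set E') Q.support) ∧
          IsWeightedSeqJR 2 ρ'' 𝔟₀ 𝔟₀ [] [] 𝔟'' Kl''.prod ℬ'' 𝒟'' := by
  intro Pl
  induction Pl with
  | nil =>
    intro Kl _ hKl _ _ hdisj ρ 𝔟' ℬ' 𝒟' hℬ _ hKlℬ _ hseq
    rw [monomialIdeal_nil, Scheme.IdealSheafData.mul_top] at hseq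
    rw [List.map_nil, List.append_nil] at hdisj
    exact ⟨ρ, 𝔟', ℬ', 𝒟', Kl, hKl, hℬ, hKlℬ, hdisj, hseq⟩
  | cons p Pl ih =>
    obtain ⟨S, e⟩ := p
    intro Kl hPl𝓔 hKl hpos hirr hdisj ρ 𝔟' ℬ' 𝒟' hℬ hPlℬ hKlℬ hN hseq
    have hS𝓔 : S ∈ 𝓔 := hPl𝓔 (S, e) List.mem_cons_self
    have hSℬ : S ∉ boundaryOf ℬ' := hPlℬ (S, e) List.mem_cons_self
    have hSirr : IsIrreducible (S.support : Set E') := hirr (S, e) List.mem_cons_self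
    have he1 : 1 ≤ e := hpos (S, e) List.mem_cons_self
    have htail𝓔 : ∀ q ∈ Pl, q.1 ∈ 𝓔 := fun q hq => hPl𝓔 q (List.mem_cons_of_mem _ hq)
    have htailpos : ∀ q ∈ Pl, 1 ≤ q.2 := fun q hq => hpos q (List.mem_cons_of_mem _ hq)
    have htailirr : ∀ q ∈ Pl, IsIrreducible (q.1.support : Set E') := fun q hq => hirr q (List.mem_cons_of_mem _ hq)
    -- disjointness bookkeeping: `Kl ++ S :: tail`
    have hdisj' : (Kl ++ S :: Pl.map Prod.fst).Pairwise (fun P Q => Disjoint (P.support : Set E') Q.support) := by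
      simpa only [List.map_cons] using hdisj
    have hSdisj_tail : ∀ P ∈ Pl.map Prod.fst, Disjoint (S.support : Set E') P.support := by
      have h := (List.pairwise_append.mp hdisj').2.1
      exact (List.pairwise_cons.mp h).1
    have hKl_disj_S : ∀ K ∈ Kl, Disjoint (K.support : Set E') S.support := fun K hK =>
      (List.pairwise_append.mp hdisj').2.2 K hK S List.mem_cons_self
    by_cases he : 2 ≤ e
    · /- PEEL the multiple component `S` -/
      rw [prod_mul_monomialIdeal_cons] at hseq
      set M := Kl.prod * monomialIdeal Pl with hM
      -- `¬ M ≤ S`: `V(S)` is non-empty and disjoint from every factor of `M`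
      have hMS : ¬ M ≤ S := by
        intro hle
        obtain ⟨x, hx⟩ := hSirr.nonempty
        have hxM : x ∈ (M.support : Set E') := Scheme.IdealSheafData.support_antitone hle hx
        rw [hM, Scheme.IdealSheafData.support_mul] at hxM
        change x ∈ ((Kl.prod).support : Set E') ∪ ((monomialIdeal Pl).support : Set E') at hxM
        rcases hxM with hxK | hxP
        · obtain ⟨K, hK, hxK⟩ := (mem_support_prod_iff Kl x).mp hxK
          exact Set.disjoint_left.mp (hKl_disj_S K hK) hxK hx
        · have hx' := support_monomialIdeal_subset Pl hxP
          simp only [Set.mem_iUnion, exists_prop] at hx'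
          obtain ⟨q, hq, hxq⟩ := hx'
          exact Set.disjoint_left.mp (hSdisj_tail q.1 (List.mem_map.mpr ⟨q, hq, rfl⟩)) hx hxq
      have hbd : boundaryOf 𝒟' = boundaryOf ℬ' := hseq.boundaryOf_eq rfl
      have h𝒟𝓔 : ∀ B ∈ boundaryOf 𝒟', B ∈ 𝓔 := fun B hB => hℬ B (hbd ▸ hB)
      have hS𝒟 : S ∉ boundaryOf 𝒟' := fun h => hSℬ (hbd ▸ h)
      have hstep := isWeightedSeqJR_peel h𝓔 hS𝓔 hSirr.isPreirreducible.isPreconnected he rfl hMS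
        (by rw [hseq.eq_host_mul_monomialIdeal]; exact fun U => Ideal.mul_le_right)
        hℬ h𝒟𝓔 hSℬ hseq.not_le_boundary (fun q hq hq0 => hN q hq hq0 (S, e) List.mem_cons_self he) hseq
      -- recurse on the tail with the same kept list
      refine ih Kl htail𝓔 hKl htailpos htailirr ?_ (fun B hB => ?_) (fun q hq hmem => ?_)
        (fun K hK hmem => ?_) (fun q hq hq0 p hp hp2 => ?_) hstep
      · -- `Kl ++ tail` pairwise disjoint
        exact hdisj'.sublist ((List.sublist_cons_self S (Pl.map Prod.fst)).append_left Kl)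
      · -- new boundary drawn from `𝓔`
        exact (mem_boundaryOf_peel_of_not_mem h𝓔 hS𝓔 hℬ hSℬ _ hB).elim (hℬ B) fun h => h ▸ hS𝓔
      · -- tail components are not boundary members
        rcases mem_boundaryOf_peel_of_not_mem h𝓔 hS𝓔 hℬ hSℬ _ hmem with h | h
        · exact hPlℬ q (List.mem_cons_of_mem _ hq) h
        · obtain ⟨x, hx⟩ := (htailirr q hq).nonempty
          exact Set.disjoint_left.mp (hSdisj_tail q.1 (List.mem_map.mpr ⟨q, hq, rfl⟩)) (h ▸ hx) hx
      · -- kept components are not boundary members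
        rcases mem_boundaryOf_peel_of_not_mem h𝓔 hS𝓔 hℬ hSℬ _ hmem with h | h
        · exact hKlℬ K hK h
        · obtain ⟨x, hx⟩ := hSirr.nonempty
          exact Set.disjoint_left.mp (hKl_disj_S K hK) (h ▸ hx) hx
      · -- no N-charged member meets a remaining multiple component
        rcases mem_peel_cases h𝓔 hS𝓔 h𝒟𝓔 hS𝒟 _ hq with h | h
        · exact hN q h hq0 p (List.mem_cons_of_mem _ hp) hp2
        · rw [h]
          exact hSdisj_tail p.1 (List.mem_map.mpr ⟨p, hp, rfl⟩)
    · /- KEEP the exponent-one component `S` -/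
      have he' : e = 1 := le_antisymm (Nat.lt_succ_iff.mp (Nat.lt_of_not_le he)) he1
      subst he'
      rw [prod_mul_monomialIdeal_cons_one] at hseq
      refine ih (Kl ++ [S]) htail𝓔 (fun K hK => ?_) htailpos htailirr (by simpa using hdisj') hℬ
        (fun q hq => hPlℬ q (List.mem_cons_of_mem _ hq)) (fun K hK => ?_) (fun q hq hq0 p hp hp2 => ?_) hseq
      · rcases List.mem_append.mp hK with hK | hK
        · exact hKl K hK
        · rw [List.mem_singleton.mp hK]; exact hS𝓔
      · rcases List.mem_append.mp hK with hK | hK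
        · exact hKlℬ K hK
        · rw [List.mem_singleton.mp hK]; exact hSℬ
      · exact hN q hq hq0 p (List.mem_cons_of_mem _ hp) hp2

/-! ## §4 The END -/

/-- **PHASE-B^nr: from the factorised transport end to `EndStateJR`** (the consumer shape required by res-D-pv-052, 11:38:11Z):
given the accumulated `IsWeightedSeqJR 2` with host `monomialIdeal Pl` factorised as in res-D-pv-055's `endPackage`, the peel loop
reaches a state `(𝔟'', Kl.prod, ℬ'', 𝒟'')` on the SAME scheme with `EndStateJR 𝔟'' Kl.prod ℬ''`: `V(Kl.prod)` regular and
`Kl.prod :: boundaryOf ℬ''` snc by `hasSNC_prod_cons`, `𝔟'' = Kl.prod · monomialIdeal ℬ''` by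
`IsWeightedSeqJR.eq_host_mul_monomialIdeal`. [cite: Kollar2007, (3.111) Step 3] -/
theorem exists_endStateJR_of_factorised [IsLocallyNoetherian E] [IsLocallyNoetherian E']
    {𝓔 : List E'.IdealSheafData} (h𝓔 : HasSNC 𝓔) {𝔟₀ : E.IdealSheafData} (Pl : List (E'.IdealSheafData × ℕ))
    (hPl𝓔 : ∀ p ∈ Pl, p.1 ∈ 𝓔) (hpos : ∀ p ∈ Pl, 1 ≤ p.2) (hirr : ∀ p ∈ Pl, IsIrreducible (p.1.support : Set E'))
    (hdisj : (Pl.map Prod.fst).Pairwise fun P Q => Disjoint (P.support : Set E') Q.support)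
    {ρ : E' ⟶ E} {𝔟' : E'.IdealSheafData} {ℬ' 𝒟' : List (E'.IdealSheafData × ℕ)}
    (hℬ : ∀ B ∈ boundaryOf ℬ', B ∈ 𝓔) (hPlℬ : ∀ p ∈ Pl, p.1 ∉ boundaryOf ℬ')
    (hN : ∀ q ∈ 𝒟', 0 < q.2 → ∀ p ∈ Pl, 2 ≤ p.2 → Disjoint (q.1.support : Set E') p.1.support)
    (hseq : IsWeightedSeqJR 2 ρ 𝔟₀ 𝔟₀ [] [] 𝔟' (monomialIdeal Pl) ℬ' 𝒟') :
    ∃ (ρ'' : E' ⟶ E) (𝔟'' D'' : E'.IdealSheafData) (ℬ'' 𝒟'' : List (E'.IdealSheafData × ℕ)),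
      IsWeightedSeqJR 2 ρ'' 𝔟₀ 𝔟₀ [] [] 𝔟'' D'' ℬ'' 𝒟'' ∧ EndStateJR 𝔟'' D'' ℬ'' := by
  have hseq' : IsWeightedSeqJR 2 ρ 𝔟₀ 𝔟₀ [] [] 𝔟' (([] : List E'.IdealSheafData).prod * monomialIdeal Pl) ℬ' 𝒟' := by
    rwa [List.prod_nil, Scheme.IdealSheafData.one_eq_top, Scheme.IdealSheafData.top_mul]
  obtain ⟨ρ'', 𝔟'', ℬ'', 𝒟'', Kl, hKl𝓔, hℬ'', hKlℬ, hKdisj, hseq''⟩ :=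
    exists_isWeightedSeqJR_prod_of_factorised h𝓔 Pl [] hPl𝓔 (fun K hK => absurd hK List.not_mem_nil) hpos hirr
      (by simpa using hdisj) hℬ hPlℬ (fun K hK => absurd hK List.not_mem_nil) hN hseq'
  have hsnc : HasSNC (Kl.prod :: boundaryOf ℬ'') := hasSNC_prod_cons h𝓔 hKl𝓔 hℬ'' hKlℬ hKdisj
  exact ⟨ρ'', 𝔟'', Kl.prod, ℬ'', 𝒟'', hseq'',
    (hsnc.hasSNCWith_of_mem List.mem_cons_self).isRegular_subscheme, hsnc, hseq''.eq_host_mul_monomialIdeal⟩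

end DepthSep

end Summit.ResolutionOfSingularities.ResolutionOfSingularities.Theorems
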